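import Mathlib
import Literature.Analysis.FluidPDE.Tao2016AveragedNS.RenormalisedCascadeWaves
import Literature.Analysis.FluidPDE.Tao2016AveragedNS.SelfSimilarCascadeBlowup
import Literature.Analysis.FluidPDE.Tao2016AveragedNS.ViscousEternalSolutions
import Literature.Analysis.FluidPDE.Tao2016AveragedNS.BoundedEternalSolutions
import Summits.NavierStokesRegularity.NavierStokesRegularity.Theses.TaoLadderRungTwoBreak
import Summits.NavierStokesRegularity.NavierStokesRegularity.Theorems.TaoLadderRungTwoBreakTwinRotorTableDefs
import Summits.NavierStokesRegularity.NavierStokesRegularity.Theorems.WakeRatchetAdmissibleEternalBoundDyadic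
import HarnessLib

/-!
# Crux `TaoLadderRungTwoBreak.NoSurvivingEternalViscBddOne` (stmt-NavierStokesRegularity-20419):
# THE DYADIC CHAIN EMBEDS INTO THE SPREAD-ONE CLASS `E₂(1)` — every K1-type statement of the route at
# ANY spread `R ≥ 1` contains its Katz–Pavlović member (twin-rotor embedding;
# `--supports stmt-NavierStokesRegularity-20419`)

MODEL lattice ODEs only (Tao 2016 §1.2, §4, §6.4); nothing in this file is a statement about the
Navier–Stokes equations, and no stub, crux, rung or summit is proved by it.

The registered stubs of ⟨20419⟩ ((ρ0) `∀ R ≥ 1, NoSurvivingEternalBdd R 1`, (ρ+) `∀ R ≥ 1, NoLoudLadder R`),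
the crux itself (K1ᵛ(1) `∀ R ≥ 1, NoSurvivingEternalViscBdd R 1`) and ⟨20205⟩'s `stub_eternalLiouville`
quantify over the comparable class `E₂(R)`, which GROWS with `R`; the weakest instance is `R = 1` (all
non-zero structure constants of modulus exactly `1`).  The tree's scalar dyadic member `dyadicTable` has
entries `1, −1/2, −1/2` and lies in `E₂(R)` iff `R ≥ 2` (`SubDyadicSpread.inTableClass_dyadicTable_iff`), and
below the dyadic spread no comparable table has a square monomial (`SubDyadicSpread.sqCoeff_eq_zero_of_lt_two`);
the census of ⟨20419⟩ therefore read the corner `1 ≤ R < 2` as «genuinely multi-mode (rotor-type), free of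
Katz–Pavlović phenomenology».  THIS FILE CORRECTS THAT READING:

* `twinRotor_lattice_field` — on the diagonal states `(w/2)·(1,1,0,0)` the vector field of the renormalised
  lattice of the pure-rotor table `twinRotorTable ∈ E₂(1)` (sibling Defs file: cross feeds
  `x_{0}x_{1} ↦` both twins of the next shell, coefficient `±1`) IS the dyadic vector field:
  the two rotors `(0,n-1) ⊳ [(1,n-1) → (1,n)]` and `(1,n-1) ⊳ [(0,n-1) → (0,n)]` add up, on the diagonal,
  to the square feed `x_{n-1}² ↦ x_n` with its back-reaction;
* `isEternalVisc_twinRotorEmbed` — hence the twin embedding `W ↦ (W_n(σ)₀/2)·(1,1,0,0)` maps every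
  admissible eternal solution of `dyadicTable` with covariant viscosity `ν̂ ≥ 0` to an admissible eternal
  solution of `twinRotorTable` with the SAME `ν̂` (law, action `∫‖·‖ ↦ ∫‖·‖/√2`, forward bound), with
  `‖·‖² ↦ ‖·‖²/2` shell by shell (`norm_sq_twinRotorEmbed`), preserving `UniformBound`
  (`uniformBound_twinRotorEmbed`) and forward (S_a)-survival for every `a` (`eternalSurvivingFwd_twinRotorEmbed_iff`),
  and halving the a=1-weighted energy (`wtEnergy_twinRotorEmbed`);
* BY NAME, for every spread `R ≥ 1` (in particular `R = 1`): `NoSurvivingEternalViscBdd R a` ⟹ its viscous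
  dyadic slice (`dyadic_of_noSurvivingEternalViscBdd`); `NoSurvivingEternalBdd R a` ⟹ its dyadic slice, with
  `UniformBound` automatic (`dyadic_of_noSurvivingEternalBdd`); `NoLoudLadder R` ⟹ the dyadic loud-ladder
  exclusion at level `ν̂²/2048` (`dyadic_of_noLoudLadder`; the factor 2 is the halved energy); and the route
  decls `NoSurvivingEternalViscBddOne` / `NoSurvivingEternalBddOne` / `NoLoudLadderOne` and ⟨20205⟩'s
  registered `stub_eternalLiouville` signature ⟹ the same slices (`…_of_NoSurvivingEternalViscBddOne`, …).

READING for the census of ⟨20419⟩/⟨20205⟩: the sub-dyadic corner `1 ≤ R < 2` is NOT an easier rung — the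
spread-one class already carries the dyadic chain (diagonally, through two cross-feeding rotors), so (ρ0) at
`R = 1` is at least as hard as the dyadic wake law W1-dyadic of the census (classical form:
`WakeDyadicClassical`), and comparability spread is not invariant under mode-doubling: the factor-`2` disparity
of the dyadic entries is a multiplicity artefact that twinning removes.  HONEST LABEL: dictionary /
embedding work; every stub of ⟨20419⟩, ⟨20420⟩, ⟨20205⟩ remains OPEN.
-/

noncomputable section

-- the sub-problem namespace repeats the summit name by design (D-0017)
set_option linter.dupNamespace false

namespace Summit.NavierStokesRegularity.NavierStokesRegularity.Theorems.TaoLadderRungTwoBreakTwinRotor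

open Filter Topology MeasureTheory Set
open scoped RealInnerProductSpace
open Literature.Analysis.FluidPDE Literature.Analysis.FluidPDE.TaoCascade
open Summit.NavierStokesRegularity.NavierStokesRegularity.Theorems.WakeRatchetDyadic
  (dyadic_hasDerivAt_apply dyadic_apply_ne_zero uniformBound_dyadic)

variable {ε₀ νh : ℝ} {W : ℤ → ℝ → Em 4}

/-! ## The twin-rotor table on diagonal states -/

/-- The cross-feed form of the twin-rotor table: `Σ α_{i₁i₂i,(0,0,1)} y_{i₁} x_{i₂} = y₀x₁ + y₁x₀` on both
twins, `0` on the idle modes. [cite: Tao2016AveragedNS, §4 (4.1), Lemma 4.1 (4.8); cell vocabulary (`qform`, sibling Defs file)] -/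
theorem qform_twinRotor_feed (y x : Em 4) (i : Fin 4) :
    qform twinRotorTable (0, 0, 1) y x i = if i = 0 ∨ i = 1 then y 0 * x 1 + y 1 * x 0 else 0 := by
  unfold qform
  fin_cases i <;> simp [Fin.sum_univ_four, twinRotorTable]

/-- The `(1,0,0)` back-reaction form of the twin-rotor table: `−y₁x₀` on twin `1`, `−y₀x₁` on twin `0`.
[cite: Tao2016AveragedNS, §4 (4.1), Lemma 4.1 (4.8); cell vocabulary (`qform`, sibling Defs file)] -/
theorem qform_twinRotor_back₁ (y x : Em 4) (i : Fin 4) :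
    qform twinRotorTable (1, 0, 0) y x i =
      if i = 1 then -(y 1 * x 0) else if i = 0 then -(y 0 * x 1) else 0 := by
  unfold qform
  fin_cases i <;> simp [Fin.sum_univ_four, twinRotorTable]

/-- The `(0,1,0)` back-reaction form of the twin-rotor table: `−y₀x₁` on twin `1`, `−y₁x₀` on twin `0`.
[cite: Tao2016AveragedNS, §4 (4.1), Lemma 4.1 (4.8); cell vocabulary (`qform`, sibling Defs file)] -/
theorem qform_twinRotor_back₂ (y x : Em 4) (i : Fin 4) :
    qform twinRotorTable (0, 1, 0) y x i =
      if i = 1 then -(y 0 * x 1) else if i = 0 then -(y 1 * x 0) else 0 := by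
  unfold qform
  fin_cases i <;> simp [Fin.sum_univ_four, twinRotorTable]

/-- The twin-rotor table has no intra-shell block. [cite: Tao2016AveragedNS, §4 (4.1); cell vocabulary (sibling Defs file)] -/
theorem qform_twinRotor_intra (y x : Em 4) (i : Fin 4) : qform twinRotorTable (0, 0, 0) y x i = 0 := by
  unfold qform
  fin_cases i <;> simp [twinRotorTable]

/-- **The dyadic vector field on the diagonal.**  On diagonal states `(w/2)·(1,1,0,0)` the renormalised
lattice field of `twinRotorTable` with feed `Λ`, drain `Λ⁻¹` and a linear damping `κ` equals
`((Λ a² − Λ⁻¹ b c − (1+κ) b)/2)·(1,1,0,0)` — the Katz–Pavlović / dyadic field `Λ a² − Λ⁻¹ b c − (1+κ) b` of the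
scalar amplitudes, halved.
[cite: Tao2016AveragedNS, §1.2 (dyadic model), §4 Lemma 4.1 (4.8), the viscous equation before Thm. 4.2, §6.4; cell vocabulary] -/
theorem twinRotor_lattice_field (Λ κ a b c : ℝ) :
    -((1 : ℝ) • ((b / 2) • twinRotorDir)) + tableQ twinRotorTable ((b / 2) • twinRotorDir)
        + Λ • tableA twinRotorTable ((a / 2) • twinRotorDir)
        + Λ⁻¹ • tableB twinRotorTable ((c / 2) • twinRotorDir) ((b / 2) • twinRotorDir)
        - κ • ((b / 2) • twinRotorDir)
      = (((Λ * (a * a) - Λ⁻¹ * (b * c)) - (1 + κ) * b) / 2) • twinRotorDir := by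
  ext i
  simp only [PiLp.add_apply, PiLp.sub_apply, PiLp.neg_apply, PiLp.smul_apply, smul_eq_mul,
    tableQ_apply, tableA_apply, tableB_apply, qform_twinRotor_feed, qform_twinRotor_back₁,
    qform_twinRotor_back₂, qform_twinRotor_intra, twinRotorDir_apply]
  fin_cases i <;> simp <;> ring

/-! ## Norms of the twin embedding -/

/-- `‖(1,1,0,0)‖ = √2`. [elementary] -/
theorem norm_twinRotorDir : ‖twinRotorDir‖ = Real.sqrt 2 := by
  have h2 : ¬ ((2 : Fin 4) = 0 ∨ (2 : Fin 4) = 1) := by decide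
  have h3 : ¬ ((3 : Fin 4) = 0 ∨ (3 : Fin 4) = 1) := by decide
  rw [EuclideanSpace.norm_eq, Fin.sum_univ_four]
  simp only [twinRotorDir_apply, if_neg h2, if_neg h3]
  norm_num

/-- `‖twinRotorEmbed W n σ‖ = (√2/2)·|W_n(σ)₀|`. [elementary] -/
theorem norm_twinRotorEmbed (W : ℤ → ℝ → Em 4) (n : ℤ) (σ : ℝ) :
    ‖twinRotorEmbed W n σ‖ = Real.sqrt 2 / 2 * |W n σ 0| := by
  rw [twinRotorEmbed_apply, norm_smul, norm_twinRotorDir, Real.norm_eq_abs, abs_div, abs_two]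
  ring

/-- `|x₀| ≤ ‖x‖` in `ℝ⁴`. [elementary] -/
theorem abs_apply_zero_le_norm (x : Em 4) : |x 0| ≤ ‖x‖ := by
  rw [EuclideanSpace.norm_eq,
    show |x 0| = Real.sqrt (|x 0| ^ 2) by rw [Real.sqrt_sq (abs_nonneg _)]]
  refine Real.sqrt_le_sqrt ?_
  rw [Fin.sum_univ_four]
  simp only [Real.norm_eq_abs]
  nlinarith [sq_nonneg (|x 1|), sq_nonneg (|x 2|), sq_nonneg (|x 3|)]

/-- `‖twinRotorEmbed W n σ‖ ≤ ‖W_n(σ)‖` for every shell family. [elementary] -/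
theorem norm_twinRotorEmbed_le (W : ℤ → ℝ → Em 4) (n : ℤ) (σ : ℝ) :
    ‖twinRotorEmbed W n σ‖ ≤ ‖W n σ‖ := by
  rw [norm_twinRotorEmbed]
  have h2 : Real.sqrt 2 / 2 ≤ 1 := by
    rw [div_le_one (by norm_num : (0:ℝ) < 2)]
    have := Real.sqrt_lt_sqrt (by norm_num : (0:ℝ) ≤ 2) (by norm_num : (2:ℝ) < 4)
    have h4 : Real.sqrt 4 = 2 := by
      rw [show (4:ℝ) = 2 ^ 2 by norm_num, Real.sqrt_sq (by norm_num : (0:ℝ) ≤ 2)]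
    linarith
  calc Real.sqrt 2 / 2 * |W n σ 0| ≤ 1 * ‖W n σ‖ :=
        mul_le_mul h2 (abs_apply_zero_le_norm _) (abs_nonneg _) zero_le_one
    _ = ‖W n σ‖ := one_mul _

/-- An admissible (viscous) eternal solution of the dyadic member is scalar: `‖W_n(σ)‖ = |W_n(σ)₀|`.
[cite: Tao2016AveragedNS, §1.2, §6.4; tree `WakeRatchetDyadic.dyadic_apply_ne_zero`] -/
theorem norm_eq_abs_apply_zero (hε : 0 < ε₀) (hW : IsEternalVisc ε₀ νh dyadicTable W) (n : ℤ) (σ : ℝ) :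
    ‖W n σ‖ = |W n σ 0| := by
  have h1 : W n σ 1 = 0 := dyadic_apply_ne_zero hε hW n (by decide) σ
  have h2 : W n σ 2 = 0 := dyadic_apply_ne_zero hε hW n (by decide) σ
  have h3 : W n σ 3 = 0 := dyadic_apply_ne_zero hε hW n (by decide) σ
  rw [EuclideanSpace.norm_eq, Fin.sum_univ_four, h1, h2, h3]
  simp only [Real.norm_eq_abs, abs_zero, ne_eq, OfNat.ofNat_ne_zero, not_false_eq_true, zero_pow,
    add_zero]
  exact Real.sqrt_sq (abs_nonneg _)

/-- On admissible dyadic solutions the twin embedding scales every shell norm by `√2/2`.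
[cite: Tao2016AveragedNS, §1.2, §6.4; this file] -/
theorem norm_twinRotorEmbed_eq (hε : 0 < ε₀) (hW : IsEternalVisc ε₀ νh dyadicTable W) (n : ℤ) (σ : ℝ) :
    ‖twinRotorEmbed W n σ‖ = Real.sqrt 2 / 2 * ‖W n σ‖ := by
  rw [norm_twinRotorEmbed, norm_eq_abs_apply_zero hε hW]

/-- On admissible dyadic solutions the twin embedding HALVES every shell energy: `‖·‖² ↦ ‖·‖²/2`.
[cite: Tao2016AveragedNS, §1.2, §6.4; this file] -/
theorem norm_sq_twinRotorEmbed (hε : 0 < ε₀) (hW : IsEternalVisc ε₀ νh dyadicTable W) (n : ℤ) (σ : ℝ) :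
    ‖twinRotorEmbed W n σ‖ ^ 2 = ‖W n σ‖ ^ 2 / 2 := by
  rw [norm_twinRotorEmbed_eq hε hW, mul_pow, div_pow, Real.sq_sqrt (by norm_num : (0:ℝ) ≤ 2)]
  ring

/-! ## The embedding theorem -/

/-- **The law.**  The twin embedding of an admissible eternal solution of `dyadicTable` (covariant viscosity
`ν̂ ≥ 0`) solves the renormalised lattice law of `twinRotorTable` with the same covariant viscosity.
[cite: Tao2016AveragedNS, §1.2, §4 Lemma 4.1 (4.8), the viscous equation before Thm. 4.2, §6.4; tree `dyadic_hasDerivAt_apply`] -/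
theorem hasDerivAt_twinRotorEmbed (hW : IsEternalVisc ε₀ νh dyadicTable W) (n : ℤ) (σ : ℝ) :
    HasDerivAt (twinRotorEmbed W n)
      (-((1 : ℝ) • twinRotorEmbed W n σ) + tableQ twinRotorTable (twinRotorEmbed W n σ)
        + bigLam ε₀ • tableA twinRotorTable (twinRotorEmbed W (n - 1) σ)
        + (bigLam ε₀)⁻¹ • tableB twinRotorTable (twinRotorEmbed W (n + 1) σ) (twinRotorEmbed W n σ)
        - (νh * ((1 + ε₀) ^ ((2 : ℝ) * n) * Real.exp (-σ))) • twinRotorEmbed W n σ) σ := by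
  have h := ((dyadic_hasDerivAt_apply hW n σ 0).div_const 2).smul_const twinRotorDir
  rw [if_pos rfl] at h
  simp only [twinRotorEmbed_apply]
  rw [twinRotor_lattice_field]
  exact h

/-- **THE TWIN-ROTOR EMBEDDING.**  For every `ε₀ > 0` and `ν̂ ≥ 0`, the twin embedding of an admissible
eternal solution of the dyadic member with covariant viscosity `ν̂` is an admissible eternal solution of the
spread-one table `twinRotorTable` with the same covariant viscosity.
[cite: Tao2016AveragedNS, §1.2, §4 Lemma 4.1 (4.8), the viscous equation before Thm. 4.2, §6.4; cell vocabulary (`IsEternalVisc`)] -/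
theorem isEternalVisc_twinRotorEmbed (hε : 0 < ε₀) (hW : IsEternalVisc ε₀ νh dyadicTable W) :
    IsEternalVisc ε₀ νh twinRotorTable (twinRotorEmbed W) where
  law := hasDerivAt_twinRotorEmbed hW
  nonneg := hW.nonneg
  action := by
    obtain ⟨M, hM⟩ := hW.action
    refine ⟨Real.sqrt 2 / 2 * M, fun n => ?_⟩
    have hfun : (fun σ => ‖twinRotorEmbed W n σ‖) = fun σ => Real.sqrt 2 / 2 * ‖W n σ‖ := by
      funext σ; exact norm_twinRotorEmbed_eq hε hW n σ
    rw [hfun, integral_const_mul]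
    exact ⟨(hM n).1.const_mul _, mul_le_mul_of_nonneg_left (hM n).2 (by positivity)⟩
  bdd := by
    intro n
    obtain ⟨σ₀, P, hP⟩ := hW.bdd n
    refine ⟨σ₀, P / 2, fun σ hσ => ?_⟩
    rw [norm_sq_twinRotorEmbed hε hW n σ]
    have := hP σ hσ
    have e : Real.exp (2 * σ) * (‖W n σ‖ ^ 2 / 2) = Real.exp (2 * σ) * ‖W n σ‖ ^ 2 / 2 := by ring
    rw [e]
    linarith

/-- The inviscid case: the twin embedding of an admissible INVISCID eternal solution of the dyadic member is an
admissible inviscid eternal solution of `twinRotorTable`.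
[cite: Tao2016AveragedNS, §1.2, §4 Lemma 4.1 (4.8), §6.4; cell vocabulary (`IsEternal`)] -/
theorem isEternal_twinRotorEmbed (hε : 0 < ε₀) (hW : IsEternal ε₀ dyadicTable W) :
    IsEternal ε₀ twinRotorTable (twinRotorEmbed W) :=
  isEternalVisc_zero_iff.1 (isEternalVisc_twinRotorEmbed hε hW.isEternalVisc)

/-- The twin embedding preserves uniform («type-I») bounds (with the same constant).
[cite: Tao2016AveragedNS, §4 Thm. 4.2 (statement shape), §6.4; cell vocabulary (`UniformBound`)] -/
theorem uniformBound_twinRotorEmbed (hU : UniformBound W) : UniformBound (twinRotorEmbed W) := by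
  obtain ⟨C, hC⟩ := hU
  exact ⟨C, fun k σ => (norm_twinRotorEmbed_le W k σ).trans (hC k σ)⟩

/-- The twin embedding halves the a=1-weighted shell energy: `wtEnergy(twin W) = wtEnergy(W)/2`.
[cite: Tao2016AveragedNS, §4 Lemma 4.1 (4.8), §6.4; cell vocabulary (`wtEnergy`)] -/
theorem wtEnergy_twinRotorEmbed (hε : 0 < ε₀) (hW : IsEternalVisc ε₀ νh dyadicTable W) (n : ℕ) (σ : ℝ) :
    wtEnergy ε₀ (twinRotorEmbed W) n σ = wtEnergy ε₀ W n σ / 2 := by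
  unfold wtEnergy
  rw [norm_sq_twinRotorEmbed hε hW]
  ring

/-- **The twin embedding preserves forward (S_a)-survival**, for every exponent `a`.
[cite: Tao2016AveragedNS, §4 (the viscous equation before Thm. 4.2), §6.4; cell vocabulary (`EternalSurvivingFwd`)] -/
theorem eternalSurvivingFwd_twinRotorEmbed_iff (hε : 0 < ε₀) (hW : IsEternalVisc ε₀ νh dyadicTable W)
    (a : ℝ) : EternalSurvivingFwd a ε₀ (twinRotorEmbed W) ↔ EternalSurvivingFwd a ε₀ W := by
  have hpw : 0 ≤ physWeight a ε₀ := physWeight_nonneg hε.le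
  constructor
  · rintro ⟨c, hc, H⟩
    refine ⟨c, hc, fun N => ?_⟩
    obtain ⟨n, hn, σ, hσ, hle⟩ := H N
    refine ⟨n, hn, σ, hσ, hle.trans ?_⟩
    rw [norm_sq_twinRotorEmbed hε hW]
    have h1 : ‖W n σ‖ ^ 2 / 2 ≤ ‖W n σ‖ ^ 2 := by nlinarith [sq_nonneg ‖W (n : ℤ) σ‖]
    exact mul_le_mul_of_nonneg_left (mul_le_mul_of_nonneg_left h1 (Real.exp_pos _).le)
      (pow_nonneg hpw n)
  · rintro ⟨c, hc, H⟩
    refine ⟨c / 2, by positivity, fun N => ?_⟩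
    obtain ⟨n, hn, σ, hσ, hle⟩ := H N
    refine ⟨n, hn, σ, hσ, ?_⟩
    rw [norm_sq_twinRotorEmbed hε hW]
    have e : physWeight a ε₀ ^ n * (Real.exp (2 * σ) * (‖W n σ‖ ^ 2 / 2))
        = physWeight a ε₀ ^ n * (Real.exp (2 * σ) * ‖W n σ‖ ^ 2) / 2 := by ring
    rw [e]
    linarith

/-! ## By name: K1-type statements at every spread `R ≥ 1` contain their dyadic member -/

/-- **`NoSurvivingEternalViscBdd R a` (K1ᵛ-type, any `R ≥ 1`) ⟹ its viscous dyadic slice.**  In particular the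
spread-ONE statement already excludes uniformly bounded surviving admissible eternal solutions of the dyadic
member with any covariant viscosity.
[cite: Tao2016AveragedNS, §4 Thm. 4.2 (statement shape), the viscous equation before it, §6.4; cell vocabulary (`NoSurvivingEternalViscBdd`)] -/
theorem dyadic_of_noSurvivingEternalViscBdd {R a : ℝ} (hR : 1 ≤ R) (h : NoSurvivingEternalViscBdd R a) :
    ∃ εs : ℝ, 0 < εs ∧ ∀ ε₀ : ℝ, 0 < ε₀ → ε₀ ≤ εs →
      ∀ (νh : ℝ) (W : ℤ → ℝ → Em 4), IsEternalVisc ε₀ νh dyadicTable W → UniformBound W →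
        ¬ EternalSurvivingFwd a ε₀ W := by
  obtain ⟨εs, hεs, H⟩ := h
  refine ⟨εs, hεs, fun ε₀ hε hle νh W hW hU hS => ?_⟩
  exact H ε₀ hε hle twinRotorTable (inTableClass_twinRotorTable hR) νh (twinRotorEmbed W)
    (isEternalVisc_twinRotorEmbed hε hW) (uniformBound_twinRotorEmbed hU)
    ((eternalSurvivingFwd_twinRotorEmbed_iff hε hW a).2 hS)

/-- **`NoSurvivingEternalBdd R a` ((ρ0)-type, any `R ≥ 1`) ⟹ its dyadic slice**, with the uniform bound
automatic on the dyadic member (`uniformBound_dyadic`): below the threshold no admissible inviscid eternal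
solution of `dyadicTable` is (S_a)-surviving forward.
[cite: Tao2016AveragedNS, §4 Thm. 4.2 (statement shape), §6.4; cell vocabulary (`NoSurvivingEternalBdd`); tree `uniformBound_dyadic`] -/
theorem dyadic_of_noSurvivingEternalBdd {R a : ℝ} (hR : 1 ≤ R) (h : NoSurvivingEternalBdd R a) :
    ∃ εs : ℝ, 0 < εs ∧ ∀ ε₀ : ℝ, 0 < ε₀ → ε₀ ≤ εs →
      ∀ W : ℤ → ℝ → Em 4, IsEternal ε₀ dyadicTable W → ¬ EternalSurvivingFwd a ε₀ W := by
  obtain ⟨εs, hεs, H⟩ := h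
  refine ⟨εs, hεs, fun ε₀ hε hle W hW hS => ?_⟩
  exact H ε₀ hε hle twinRotorTable (inTableClass_twinRotorTable hR) (twinRotorEmbed W)
    (isEternal_twinRotorEmbed hε hW) (uniformBound_twinRotorEmbed (uniformBound_dyadic hε hW))
    ((eternalSurvivingFwd_twinRotorEmbed_iff hε hW.isEternalVisc a).2 hS)

/-- **`NoLoudLadder R` ((ρ+)-type, any `R ≥ 1`) ⟹ the dyadic loud-ladder exclusion at level `ν̂²/2048`**: below
the threshold, no uniformly bounded admissible eternal solution of the dyadic member with `ν̂ > 0` in which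
every shell's a=1-weighted energy exceeds every level `< ν̂²/2048` is (S₁)-surviving forward (the embedding
halves the weighted energy, hence the doubled level).
[cite: Tao2016AveragedNS, §4 Thm. 4.2 (statement shape), the viscous equation before it, §6.4; cell vocabulary (`NoLoudLadder`, `wtEnergy`)] -/
theorem dyadic_of_noLoudLadder {R : ℝ} (hR : 1 ≤ R) (h : NoLoudLadder R) :
    ∃ εs : ℝ, 0 < εs ∧ ∀ ε₀ : ℝ, 0 < ε₀ → ε₀ ≤ εs →
      ∀ (νh : ℝ) (W : ℤ → ℝ → Em 4), 0 < νh → IsEternalVisc ε₀ νh dyadicTable W → UniformBound W →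
        (∀ n₀ : ℕ, ∀ s₀ : ℝ, s₀ < νh ^ 2 / 2048 → ∃ σ : ℝ, s₀ < wtEnergy ε₀ W n₀ σ) →
          ¬ EternalSurvivingFwd 1 ε₀ W := by
  obtain ⟨εs, hεs, H⟩ := h
  refine ⟨εs, hεs, fun ε₀ hε hle νh W hν hW hU hloud hS => ?_⟩
  refine H ε₀ hε hle twinRotorTable (inTableClass_twinRotorTable hR) νh (twinRotorEmbed W) hν
    (isEternalVisc_twinRotorEmbed hε hW) (uniformBound_twinRotorEmbed hU) ?_
    ((eternalSurvivingFwd_twinRotorEmbed_iff hε hW 1).2 hS)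
  intro n₀ s₀ hs₀
  obtain ⟨σ, hσ⟩ := hloud n₀ (2 * s₀) (by linarith)
  refine ⟨σ, ?_⟩
  rw [wtEnergy_twinRotorEmbed hε hW]
  linarith

/-! ## By name: the route decls and the registered stub of ⟨20205⟩ -/

/-- **The crux ⟨20419⟩ `NoSurvivingEternalViscBddOne` ⟹ its viscous dyadic slice at `a = 1`** (through the
spread-one instance `R = 1`). [cite: Tao2016AveragedNS, §4 Thm. 4.2 (statement shape), §6.4; cell vocabulary (stmt-NavierStokesRegularity-20419)] -/
theorem dyadic_of_NoSurvivingEternalViscBddOne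
    (h : Summit.NavierStokesRegularity.NavierStokesRegularity.Theses.TaoLadderRungTwoBreak.NoSurvivingEternalViscBddOne) :
    ∃ εs : ℝ, 0 < εs ∧ ∀ ε₀ : ℝ, 0 < ε₀ → ε₀ ≤ εs →
      ∀ (νh : ℝ) (W : ℤ → ℝ → Em 4), IsEternalVisc ε₀ νh dyadicTable W → UniformBound W →
        ¬ EternalSurvivingFwd 1 ε₀ W :=
  dyadic_of_noSurvivingEternalViscBdd le_rfl (h 1 le_rfl)

/-- **(ρ0) `NoSurvivingEternalBddOne` (stmt-…-20451, the registered stub `stub_noSurvivingEternalBddOne` of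
⟨20419⟩) ⟹ its dyadic slice at `a = 1`** (through `R = 1`). [cite: Tao2016AveragedNS, §4 Thm. 4.2 (statement shape), §6.4; cell vocabulary (stmt-NavierStokesRegularity-20451)] -/
theorem dyadic_of_NoSurvivingEternalBddOne
    (h : Summit.NavierStokesRegularity.NavierStokesRegularity.Theses.TaoLadderRungTwoBreak.NoSurvivingEternalBddOne) :
    ∃ εs : ℝ, 0 < εs ∧ ∀ ε₀ : ℝ, 0 < ε₀ → ε₀ ≤ εs →
      ∀ W : ℤ → ℝ → Em 4, IsEternal ε₀ dyadicTable W → ¬ EternalSurvivingFwd 1 ε₀ W :=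
  dyadic_of_noSurvivingEternalBdd le_rfl (h 1 le_rfl)

/-- **(ρ+) `NoLoudLadderOne` (stmt-…-20452, the registered stub `stub_noLoudLadderOne` of ⟨20419⟩) ⟹ the dyadic
loud-ladder exclusion at level `ν̂²/2048`** (through `R = 1`). [cite: Tao2016AveragedNS, §4 Thm. 4.2 (statement shape), §6.4; cell vocabulary (stmt-NavierStokesRegularity-20452)] -/
theorem dyadic_of_NoLoudLadderOne
    (h : Summit.NavierStokesRegularity.NavierStokesRegularity.Theses.TaoLadderRungTwoBreak.NoLoudLadderOne) :
    ∃ εs : ℝ, 0 < εs ∧ ∀ ε₀ : ℝ, 0 < ε₀ → ε₀ ≤ εs →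
      ∀ (νh : ℝ) (W : ℤ → ℝ → Em 4), 0 < νh → IsEternalVisc ε₀ νh dyadicTable W → UniformBound W →
        (∀ n₀ : ℕ, ∀ s₀ : ℝ, s₀ < νh ^ 2 / 2048 → ∃ σ : ℝ, s₀ < wtEnergy ε₀ W n₀ σ) →
          ¬ EternalSurvivingFwd 1 ε₀ W :=
  dyadic_of_noLoudLadder le_rfl (h 1 le_rfl)

/-- **⟨20205⟩'s registered stub `stub_eternalLiouville` (the UNBOUNDED inviscid Liouville `∀ R ≥ 1`, its
signature verbatim as hypothesis) ⟹ its dyadic slice** (through `R = 1`; no `UniformBound` anywhere).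
[cite: Tao2016AveragedNS, §4 Thm. 4.2 (statement shape), §6.4; cell vocabulary (stmt-NavierStokesRegularity-20205)] -/
theorem dyadic_of_stub_eternalLiouville
    (h : ∀ R : ℝ, 1 ≤ R → ∃ εs : ℝ, 0 < εs ∧ ∀ ε₀ : ℝ, 0 < ε₀ → ε₀ ≤ εs →
      ∀ α : (Fin 4 → Fin 4 → Fin 4 → ℤ × ℤ × ℤ → ℝ), InTableClass R α →
        ∀ W : ℤ → ℝ → Em 4, IsEternal ε₀ α W → ¬ EternalSurvivingFwd 1 ε₀ W) :
    ∃ εs : ℝ, 0 < εs ∧ ∀ ε₀ : ℝ, 0 < ε₀ → ε₀ ≤ εs →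
      ∀ W : ℤ → ℝ → Em 4, IsEternal ε₀ dyadicTable W → ¬ EternalSurvivingFwd 1 ε₀ W := by
  obtain ⟨εs, hεs, H⟩ := h 1 le_rfl
  refine ⟨εs, hεs, fun ε₀ hε hle W hW hS => ?_⟩
  exact H ε₀ hε hle twinRotorTable (inTableClass_twinRotorTable le_rfl) (twinRotorEmbed W)
    (isEternal_twinRotorEmbed hε hW) ((eternalSurvivingFwd_twinRotorEmbed_iff hε hW.isEternalVisc 1).2 hS)

end Summit.NavierStokesRegularity.NavierStokesRegularity.Theorems.TaoLadderRungTwoBreakTwinRotor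

end
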